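import Summits.CriticalPhenomena.CardyFormulaZ2.Theorems.CardyBoundaryCoulombGasHalfPlaneMarkDensityLawInterleave
import Literature.Probability.Percolation.RSW

/-!
# `HalfPlaneMarkDensityLaw` (crux stmt-CriticalPhenomena-5661), line `Sketch`, lead c12-0:
# the converse unit-scale surgery for first-hit events — deterministic half

For the first-hit event `E(k) = firstHit H A k₀ k` of the lattice half-plane `H = ℤ × ℕ`
(`(k,0)` is the `k₀`-most vertex of `[k₀,∞)×{0}` joined inside `H` to the boundary arc
`A = [α,β]×{0}`, `β < k₀`), moving the hit point one site to the RIGHT is a bounded-cost surgery.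
Write `K = (k,0)`, `Kl = (k-1,0)`, `Kr = (k+1,0)`, `Ku = (k,1)`, `Kru = (k+1,1)` and
`e₁ = KKr`, `e₂ = KlK`, `e₃ = KKu`, `e₄ = KuKru`, `e₅ = KruKr`.  On `E(k)` with `k₀ + 1 ≤ k`:
* `left_edge_closed`: `e₂` is closed (else `Kl ∈ [k₀,k)` would be joined to `A`);
* CASE I (`Kr` is joined to `A` inside `H ∖ {K}`): closing `e₁, e₃` gives a configuration of
  `E(k+1)` (`caseI_surgery`);
* CASE II (not case I): then `Ku` is joined to `A` inside `H ∖ {K}` and `e₃` is open (`caseII_up`),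
  and no vertex of `[k₀,k)×{0}` is joined inside `H ∖ {K}` to `Kr` or to `Kru`
  (`caseII_not_conn_right`) — the planarity lemma `stub_interleave` (a path of the cluster of `A`
  from `A` to `K` separates `[k₀,k)×{0}` from `(k+1, ·)`); the case II surgery itself (closing
  `e₁, e₃`, opening `e₄, e₅`) is in the sequel `…FirstHitPredDet2.lean`, and the probabilistic half
  (flip invariance of `P_{1/2}`: `P[E(k)] ≤ 20·P[E(k+1)]`) is assembled separately.
Pure lattice-path combinatorics; no new definitions.
-/

noncomputable section

namespace Summit.CriticalPhenomena.CardyFormulaZ2.Cruxes.HalfPlaneMarkDensityLaw.SketchLine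

open Literature.Probability.Percolation Literature.Probability.LatticeModels
open MeasureTheory Filter Set SimpleGraph
open scoped Topology
open Summit.CriticalPhenomena.CardyFormulaZ2.Theorems.HalfPlaneMarkDensityLaw.Negative

namespace TwoArmLower

/-! ### Small lattice facts -/

/-- The `H`-neighbours of the boundary vertex `(k,0)`: `(k-1,0)`, `(k+1,0)` or `(k,1)`. [folklore] -/
lemma adj_bpt_cases {k : ℤ} {u : Site 2} (h : (zdGraph 2).Adj (bpt k) u) (hu : 0 ≤ u 1) :
    u = bpt (k - 1) ∨ u = bpt (k + 1) ∨ u = ![k, 1] := by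
  rw [zdGraph_two_adj_iff] at h
  simp only [bpt, Matrix.cons_val_zero, Matrix.cons_val_one] at h
  have hu' : u = ![u 0, u 1] := by ext i; fin_cases i <;> rfl
  rcases h with ⟨h0, h1⟩ | ⟨h0, h1⟩ | ⟨h1, h0⟩ | ⟨h1, h0⟩
  · right; left; rw [hu']; ext i; fin_cases i <;> simp [bpt] <;> omega
  · left; rw [hu']; ext i; fin_cases i <;> simp [bpt] <;> omega
  · right; right; rw [hu']; ext i; fin_cases i <;> simp <;> omega
  · exfalso; omega

/-- **Last-edge lemma.** A non-trivial open walk inside `S` ending at `y` enters `y` through an open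
edge from an `S`-vertex adjacent to `y`, reached from the start inside `S` with the vertices of the
walk before it. [folklore] -/
lemma exists_last_edge {ω : BondConfig (Site 2)} (hω : ω ⊆ (zdGraph 2).edgeSet) {S : Set (Site 2)}
    {x y : Site 2} (hxy : x ≠ y) (h : ω ∈ openConnIn S x y) :
    ∃ u : Site 2, u ∈ S ∧ (zdGraph 2).Adj y u ∧ s(y, u) ∈ ω ∧ ω ∈ openConnIn (S \ {y}) x u := by
  classical
  obtain ⟨p, hpS, hpω⟩ := exists_walk_of_mem_openConnIn hω h
  -- pass to a path, reverse it, and read off its first edge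
  set q := p.bypass with hq
  have hqS : ∀ z ∈ q.support, z ∈ S := fun z hz => hpS z (p.support_bypass_subset_support hz)
  have hqω : ∀ e ∈ q.edges, e ∈ ω := fun e he => hpω e (p.edges_bypass_subset_edges he)
  have hqpath : q.IsPath := p.bypass_isPath
  set r := q.reverse with hr
  have hrpath : r.IsPath := hqpath.reverse
  have hrS : ∀ z ∈ r.support, z ∈ S := fun z hz => hqS z (by rwa [hr, Walk.support_reverse, List.mem_reverse] at hz)
  have hrω : ∀ e ∈ r.edges, e ∈ ω := fun e he => hqω e (by rwa [hr, Walk.edges_reverse, List.mem_reverse] at he)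
  clear_value r
  cases r with
  | nil => exact absurd rfl hxy
  | cons hadj r' =>
    rename_i u
    rw [Walk.cons_isPath_iff] at hrpath
    refine ⟨u, hrS u (by simp), hadj, hrω _ (by simp), ?_⟩
    rw [openConnIn_comm]
    refine mem_openConnIn_of_walk r' (fun z hz => ⟨hrS z (by simp [hz]), fun hzy => ?_⟩)
      (fun e he => hrω e (by simp [he]))
    rw [mem_singleton_iff] at hzy
    exact hrpath.2 (hzy ▸ hz)

/-! ### The setting: `E(k)` with the arc left of the window -/

section Setting

variable {ω : BondConfig (Site 2)} {α β k₀ k : ℤ}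

/-- On `E(k)` (`β < k₀ ≤ k - 1`), the boundary edge `(k-1,0)(k,0)` is closed. [folklore] -/
lemma left_edge_closed (hβ : β < k₀) (hk : k₀ + 1 ≤ k)
    (hE : ω ∈ firstHit halfPlane (rowIcc α β) k₀ k) : s(bpt (k - 1), bpt k) ∉ ω := by
  intro he
  obtain ⟨⟨x, hx, y, hy, hxy⟩, hnot⟩ := hE
  obtain rfl : y = bpt k := hy
  refine hnot ⟨x, hx, bpt (k - 1), ⟨rfl, by show k₀ ≤ k - 1; omega, by show k - 1 < k; omega⟩, ?_⟩
  refine PlanarDuality.openConnIn_trans hxy (openConnIn_of_adj (by show (0:ℤ) ≤ 0; rfl)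
    (by show (0:ℤ) ≤ 0; rfl) (by rwa [Sym2.eq_swap]) ?_)
  simp only [ne_eq, bpt]
  intro h
  have := congrFun h 0
  simp at this
  exact absurd hβ (by omega)

/-- On `E(k)`, no vertex of `A` is `(k,0)` and `A` lies in `H`. [folklore] -/
lemma arc_point_ne (hβ : β < k₀) (hk : k₀ + 1 ≤ k) {x : Site 2} (hx : x ∈ rowIcc α β) : x ≠ bpt k := by
  rintro rfl
  obtain ⟨-, -, h3⟩ := hx
  simp [bpt] at h3
  omega

/-- **No open walk of `H` in a configuration whose only possibly-open `H`-edge at `(k,0)` is towards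
`(k-1,0)` reaches `(k,0)` from `A`** — on `E(k)` the edge `(k-1,0)(k,0)` is closed, so if `e₁, e₃`
are closed too, `(k,0)` is unreachable from `A` inside `H`. [folklore] -/
lemma not_conn_K_of_closed (hβ : β < k₀) (hk : k₀ + 1 ≤ k)
    (hE : ω ∈ firstHit halfPlane (rowIcc α β) k₀ k) {ω' : BondConfig (Site 2)}
    (hω' : ω' ⊆ (zdGraph 2).edgeSet) (h1 : s(bpt k, bpt (k + 1)) ∉ ω') (h3 : s(bpt k, ![k, 1]) ∉ ω')
    (h2 : s(bpt (k - 1), bpt k) ∈ ω' → s(bpt (k - 1), bpt k) ∈ ω)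
    {x : Site 2} (hx : x ∈ rowIcc α β) : ω' ∉ openConnIn halfPlane x (bpt k) := by
  intro h
  obtain ⟨u, huH, hadj, he, -⟩ := exists_last_edge hω' (arc_point_ne hβ hk hx) h
  rcases adj_bpt_cases hadj huH with rfl | rfl | rfl
  · exact left_edge_closed hβ hk hE (h2 (by rwa [Sym2.eq_swap]))
  · exact h1 he
  · exact h3 he

/-! ### Case I -/

/-- **Case I surgery.** On `E(k)`, if `(k+1,0)` is joined to `A` inside `H ∖ {(k,0)}`, then closing
`e₁ = (k,0)(k+1,0)` and `e₃ = (k,0)(k,1)` yields a configuration of `E(k+1)`. [folklore] -/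
theorem caseI_surgery (hω : ω ⊆ (zdGraph 2).edgeSet) (hβ : β < k₀) (hk : k₀ + 1 ≤ k)
    (hE : ω ∈ firstHit halfPlane (rowIcc α β) k₀ k)
    (hI : ω ∈ openCrossing (halfPlane \ {bpt k}) (rowIcc α β) {bpt (k + 1)}) :
    ω \ {s(bpt k, bpt (k + 1)), s(bpt k, ![k, 1])} ∈ firstHit halfPlane (rowIcc α β) k₀ (k + 1) := by
  set ω' := ω \ {s(bpt k, bpt (k + 1)), s(bpt k, ![k, 1])} with hω'def
  have hω'ω : ω' ⊆ ω := fun _ h => h.1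
  have hω' : ω' ⊆ (zdGraph 2).edgeSet := hω'ω.trans hω
  constructor
  · -- the joining walk avoids `(k,0)`, hence uses no edge at `(k,0)`
    obtain ⟨x, hx, y, hy, hxy⟩ := hI
    obtain rfl : y = bpt (k + 1) := hy
    obtain ⟨p, hpS, hpω⟩ := exists_walk_of_mem_openConnIn hω hxy
    refine ⟨x, hx, bpt (k + 1), rfl, mem_openConnIn_of_walk p (fun z hz => (hpS z hz).1) fun e he => ?_⟩
    refine ⟨hpω e he, ?_⟩
    have hK : bpt k ∉ e := fun hKe => (hpS _ (p.mem_support_of_mem_edges he hKe)).2 rfl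
    rintro (rfl | rfl) <;> exact hK (Sym2.mem_mk_left _ _)
  · rintro ⟨x, hx, v, ⟨hv1, hv0, hv0'⟩, hxv⟩
    rcases lt_or_eq_of_le (Int.lt_add_one_iff.1 hv0') with hvk | hvk
    · exact hE.2 ⟨x, hx, v, ⟨hv1, hv0, hvk⟩, isUpperSet_openConnIn _ _ _ hω'ω hxv⟩
    · have hv : v = bpt k := (site_eq_bpt_iff v k).2 ⟨hv1, hvk⟩
      rw [hv] at hxv
      refine not_conn_K_of_closed hβ hk hE hω' (fun h => h.2 (Or.inl rfl)) (fun h => h.2 (Or.inr rfl))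
        (fun h => h.1) hx hxv

/-! ### Case II -/

/-- **Case II, the upward edge.** On `E(k)`, if `(k+1,0)` is NOT joined to `A` inside `H ∖ {(k,0)}`,
then `(k,1)` is, and the edge `(k,0)(k,1)` is open: the last edge of a joining path enters `(k,0)`
from `(k,1)` (from `(k-1,0)` is excluded by `E(k)`, from `(k+1,0)` by the hypothesis). [folklore] -/
theorem caseII_up (hω : ω ⊆ (zdGraph 2).edgeSet) (hβ : β < k₀) (hk : k₀ + 1 ≤ k)
    (hE : ω ∈ firstHit halfPlane (rowIcc α β) k₀ k)
    (hnI : ω ∉ openCrossing (halfPlane \ {bpt k}) (rowIcc α β) {bpt (k + 1)}) :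
    ω ∈ openCrossing (halfPlane \ {bpt k}) (rowIcc α β) {![k, 1]} ∧ s(bpt k, ![k, 1]) ∈ ω := by
  obtain ⟨x, hx, y, hy, hxy⟩ := hE.1
  obtain rfl : y = bpt k := hy
  obtain ⟨u, huH, hadj, he, hxu⟩ := exists_last_edge hω (arc_point_ne hβ hk hx) hxy
  rcases adj_bpt_cases hadj huH with rfl | rfl | rfl
  · exact absurd (by rwa [Sym2.eq_swap] : s(bpt (k - 1), bpt k) ∈ ω) (left_edge_closed hβ hk hE)
  · exact absurd ⟨x, hx, bpt (k + 1), rfl, hxu⟩ hnI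
  · exact ⟨⟨x, hx, _, rfl, hxu⟩, he⟩

/-- In case II, no vertex of `[k₀,k)×{0}` is joined inside `H ∖ {(k,0)}` (in `ω`) to `(k+1,0)`,
nor to `(k+1,1)`: a joining walk, interleaved with the path of the cluster of `A` from `A` through
`(k,1)` to `(k,0)`, would meet it (`stub_interleave`). [folklore] -/
theorem caseII_not_conn_right (hω : ω ⊆ (zdGraph 2).edgeSet) (hβ : β < k₀) (hk : k₀ + 1 ≤ k)
    (hE : ω ∈ firstHit halfPlane (rowIcc α β) k₀ k)
    (hnI : ω ∉ openCrossing (halfPlane \ {bpt k}) (rowIcc α β) {bpt (k + 1)})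
    {v : Site 2} (hv : v ∈ rowIco k₀ k) :
    ω ∉ openConnIn (halfPlane \ {bpt k}) v (bpt (k + 1)) ∧
      ω ∉ openConnIn (halfPlane \ {bpt k}) v ![k + 1, 1] := by
  classical
  obtain ⟨⟨x, hx, y, hy, hxu⟩, he3⟩ := caseII_up hω hβ hk hE hnI
  obtain rfl : y = ![k, 1] := hy
  obtain ⟨hv1, hv0, hv0'⟩ := hv
  obtain ⟨hx1, hxα, hxβ⟩ := hx
  have hxeq : x = bpt (x 0) := (site_eq_bpt_iff x (x 0)).2 ⟨hx1, rfl⟩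
  have hveq : v = bpt (v 0) := (site_eq_bpt_iff v (v 0)).2 ⟨hv1, rfl⟩
  -- the path `P` of the cluster of `A`: `x → (k,1)` inside `H ∖ {K}`, then the edge to `K`
  obtain ⟨p, hpS, hpω⟩ := exists_walk_of_mem_openConnIn hω hxu
  have hadj3 : (zdGraph 2).Adj (![k, 1] : Site 2) (bpt k) := by
    rw [zdGraph_two_adj_iff]; simp [bpt]
  set P : (zdGraph 2).Walk x (bpt k) := p.append (Walk.cons hadj3 Walk.nil) with hP
  have hPsupp : ∀ z ∈ P.support, z ∈ p.support ∨ z = bpt k := by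
    intro z hz
    rw [hP, Walk.support_append, List.mem_append, Walk.support_cons, List.tail_cons, Walk.support_nil,
      List.mem_singleton] at hz
    exact hz
  have hPH : ∀ z ∈ P.support, 0 ≤ z 1 := by
    intro z hz
    rcases hPsupp z hz with hz | rfl
    · exact (hpS z hz).1
    · show (0 : ℤ) ≤ 0; rfl
  -- a common vertex of `P` with a walk `Q` from `v` inside `H ∖ {K}` with open edges joins `v` to `A`
  have key : ∀ {t : Site 2} (Q : (zdGraph 2).Walk v t), (∀ z ∈ Q.support, z ∈ halfPlane \ {bpt k}) →
      (∀ e ∈ Q.edges, e ∈ ω) → ∀ z ∈ p.support, z ∈ Q.support → False := by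
    intro t Q hQS hQω z hzp hzQ
    have h1 : ω ∈ openConnIn (halfPlane \ {bpt k}) x z := mem_openConnIn_of_mem_support p hpS hpω hzp
    have h2 : ω ∈ openConnIn (halfPlane \ {bpt k}) v z := mem_openConnIn_of_mem_support Q hQS hQω hzQ
    have h3 : ω ∈ openConnIn halfPlane x v :=
      openConnIn_mono (fun _ h => h.1) _ _ (PlanarDuality.openConnIn_trans h1 (by rw [openConnIn_comm]; exact h2))
    exact hE.2 ⟨x, ⟨hx1, hxα, hxβ⟩, v, ⟨hv1, hv0, hv0'⟩, h3⟩
  have hxlt : x 0 < v 0 := by omega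
  constructor
  · intro h
    obtain ⟨Q, hQS, hQω⟩ := exists_walk_of_mem_openConnIn hω h
    have hQH : ∀ z ∈ Q.support, 0 ≤ z 1 := fun z hz => (hQS z hz).1
    obtain ⟨z, hzP, hzQ⟩ := stub_interleave (x 0) (v 0) k (k + 1) hxlt hv0' (by omega)
      (P.copy hxeq rfl) (Q.copy hveq rfl) (by simpa using hPH) (by simpa using hQH)
    rw [Walk.support_copy] at hzP hzQ
    rcases hPsupp z hzP with hzp | rfl
    · exact key Q hQS hQω z hzp hzQ
    · exact (hQS _ hzQ).2 rfl
  · intro h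
    obtain ⟨Q, hQS, hQω⟩ := exists_walk_of_mem_openConnIn hω h
    have hadj5 : (zdGraph 2).Adj (![k + 1, 1] : Site 2) (bpt (k + 1)) := by
      rw [zdGraph_two_adj_iff]; simp [bpt]
    set Q' : (zdGraph 2).Walk v (bpt (k + 1)) := Q.append (Walk.cons hadj5 Walk.nil) with hQ'
    have hQ'supp : ∀ z ∈ Q'.support, z ∈ Q.support ∨ z = bpt (k + 1) := by
      intro z hz
      rw [hQ', Walk.support_append, List.mem_append, Walk.support_cons, List.tail_cons, Walk.support_nil,
        List.mem_singleton] at hz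
      exact hz
    have hQ'H : ∀ z ∈ Q'.support, 0 ≤ z 1 := by
      intro z hz
      rcases hQ'supp z hz with hz | rfl
      · exact (hQS z hz).1
      · show (0 : ℤ) ≤ 0; rfl
    obtain ⟨z, hzP, hzQ⟩ := stub_interleave (x 0) (v 0) k (k + 1) hxlt hv0' (by omega)
      (P.copy hxeq rfl) (Q'.copy hveq rfl) (by simpa using hPH) (by simpa using hQ'H)
    rw [Walk.support_copy] at hzP hzQ
    rcases hQ'supp z hzQ with hzQ | rfl
    · rcases hPsupp z hzP with hzp | rfl
      · exact key Q hQS hQω z hzp hzQ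
      · exact (hQS _ hzQ).2 rfl
    · -- `(k+1,0)` on `P`: then it lies on `p`, so it is joined to `A` inside `H ∖ {K}` — case I
      rcases hPsupp _ hzP with hzp | hKK
      · exact hnI ⟨x, ⟨hx1, hxα, hxβ⟩, bpt (k + 1), rfl, mem_openConnIn_of_mem_support p hpS hpω hzp⟩
      · have := congrFun hKK 0
        simp [bpt] at this

/-! ### Registered form (Case I) -/

/-- **STUB (registered signature): Case I surgery** for the first-hit events of a boundary arc left of
the window. [folklore] -/
theorem stub_caseI_surgery :
    ∀ {ω : BondConfig (Site 2)} {α β k₀ k : ℤ}, ω ⊆ (zdGraph 2).edgeSet → β < k₀ → k₀ + 1 ≤ k →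
      ω ∈ firstHit halfPlane (rowIcc α β) k₀ k →
      ω ∈ openCrossing (halfPlane \ {bpt k}) (rowIcc α β) {bpt (k + 1)} →
      ω \ {s(bpt k, bpt (k + 1)), s(bpt k, ![k, 1])} ∈ firstHit halfPlane (rowIcc α β) k₀ (k + 1) :=
  fun hω hβ hk hE hI => caseI_surgery hω hβ hk hE hI


end Setting

end TwoArmLower

end Summit.CriticalPhenomena.CardyFormulaZ2.Cruxes.HalfPlaneMarkDensityLaw.SketchLine
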